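import Summits.KontsevichZagierPeriods.KontsevichZagierPeriods.Theorems.SymplecticScissorsRealOnePeriodRelationsStubRealises
import Literature.NumberTheory.Transcendental.CurvePeriodsEllipticFormsProofs
import Literature.NumberTheory.Transcendental.KZSemialgebraicComplex
import Literature.NumberTheory.Transcendental.SemialgebraicLineDeriv
import Mathlib.Analysis.SpecialFunctions.Sqrt

/-!
# `RealOnePeriodRelations` (stmt-KontsevichZagierPeriods-10042), line `nash-retraction-thin-strip`,
# reshape 4 (the unconditional elliptic layer): stub `stub_ellPath` — THE PATH

For real algebraic `A, B, a < b` with `4A³ + 27B² ≠ 0` and `f = x³ + Ax + B > 0` on `(a, b)`, the real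
branch `y = √f(x)` of the affine Weierstrass curve `E_{A,B} : y² = f(x)` over `[a, b]`, reparametrised by
the cubic `x(t) = a + (b − a)(3t² − 2t³)`, is a `C¹` path on `weierCurve A B` (Huber–Wüstholz 2022,
§3.3.1: a `CurvePeriods.CurvePath`) with algebraic end points `(a, √f(a))`, `(b, √f(b))`, and its real and
imaginary parts are `ℚ`-semialgebraic functions on `[0, 1]`.

The point of the cubic reparametrisation: `x(t) − a = (b − a) t² (3 − 2t)` and
`b − x(t) = (b − a) (1 − t)² (1 + 2t)`, so `x` maps `[0,1]` onto `[a,b]` and `(0,1)` into `(a,b)`; if `f`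
vanishes at an end point, say `f(a) = 0`, then `a` is a SIMPLE root (`f(a) = f′(a) = 0` forces
`4A³ + 27B² = 0` by the Bézout identity `V f′ − U f = 4A³ + 27B²`) with `f′(a) > 0` (`f > 0` to the right
of `a`), and `f(x(t)) = t² · h(t)` with `h(0) = 3 (b − a) f′(a) > 0`, so that `√f(x(t)) = t √h(t)` is `C¹`
at `t = 0` from the right; symmetrically at `t = 1` with the factor `(1 − t)²`.  Everything here is
folklore calculus; the semialgebraicity clause is Tarski–Seidenberg bookkeeping
(Bochnak–Coste–Roy 1998, §2.2) with the tree's `IsSemialgebraicFunOn` kit.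
-/

noncomputable section

open scoped BigOperators Polynomial
open Set MeasureTheory MvPolynomial
open Literature.NumberTheory.Transcendental Literature.NumberTheory.Transcendental.CurvePeriods
open Literature.ModelTheory.ExponentialFields (IsSemialgebraic)

namespace Summit.KontsevichZagierPeriods.SymplecticScissors.RealOnePeriodRelations.EllipticLayer

/-! ## Elementary lemmas -/

/-- A continuous function which is positive on `(a, b)`, `a < b`, is non-negative on `[a, b]`
(`[a, b]` is the closure of `(a, b)`). [folklore] -/
theorem nonneg_on_Icc_of_pos_on_Ioo {P : ℝ → ℝ} (hP : Continuous P) {a b : ℝ} (hab : a < b)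
    (h : ∀ x ∈ Ioo a b, 0 < P x) : ∀ x ∈ Icc a b, 0 ≤ P x := by
  have hcl : closure (Ioo a b) ⊆ {x | 0 ≤ P x} :=
    (isClosed_le continuous_const hP).closure_subset_iff.mpr fun x hx => (h x hx).le
  rw [closure_Ioo hab.ne] at hcl
  exact fun x hx => hcl hx

/-- LOCAL `Cⁿ`-NESS OF `√g` AT A DOUBLE ZERO: if on `s` one has `g = φ² · h` with `φ ≥ 0` on `s`,
`φ, h` of class `Cⁿ` at `t₀ ∈ s` and `h(t₀) ≠ 0`, then `√g = φ · √h` on `s` is `Cⁿ` within `s` at `t₀`.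
[folklore] -/
theorem contDiffWithinAt_sqrt_of_eq_sq_mul {n : WithTop ℕ∞} {g φ h : ℝ → ℝ} {s : Set ℝ} {t₀ : ℝ}
    (ht₀ : t₀ ∈ s) (hφ : ContDiffAt ℝ n φ t₀) (hh : ContDiffAt ℝ n h t₀) (hh₀ : h t₀ ≠ 0)
    (hφs : ∀ t ∈ s, 0 ≤ φ t) (hg : ∀ t ∈ s, g t = φ t ^ 2 * h t) :
    ContDiffWithinAt ℝ n (fun t => Real.sqrt (g t)) s t₀ := by
  have he : ∀ t ∈ s, Real.sqrt (g t) = φ t * Real.sqrt (h t) := fun t ht => by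
    rw [hg t ht, Real.sqrt_mul (sq_nonneg _), Real.sqrt_sq (hφs t ht)]
  exact (hφ.mul (hh.sqrt hh₀)).contDiffWithinAt.congr he (he t₀ ht₀)

/-! ## The cubic `f = x³ + Ax + B` near a real root bounding a positivity interval -/

/-- A root `e` of `f = x³ + Ax + B` with `4A³ + 27B² ≠ 0` is simple: `f′(e) = 3e² + A ≠ 0` (the Bézout
identity `(6Ae² − 9Be + 4A²) f′(e) − (18Ae − 27B) f(e) = 4A³ + 27B²`). [folklore] -/
theorem deriv_ne_zero_of_root {A B e : ℝ} (hD : 4 * A ^ 3 + 27 * B ^ 2 ≠ 0)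
    (he : e ^ 3 + A * e + B = 0) : 3 * e ^ 2 + A ≠ 0 := fun h =>
  hD (by linear_combination (6 * A * e ^ 2 - 9 * B * e + 4 * A ^ 2) * h - (18 * A * e - 27 * B) * he)

/-- If `f > 0` on `(a, b)` and `f(a) = 0` then `f′(a) > 0`: `f(x) = (x − a) · q(x)` with
`q(x) = x² + ax + a² + A > 0` on `(a, b)`, hence `q(a) = f′(a) ≥ 0`, and `f′(a) ≠ 0`. [folklore] -/
theorem deriv_pos_of_root_left {A B a b : ℝ} (hab : a < b) (hD : 4 * A ^ 3 + 27 * B ^ 2 ≠ 0)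
    (hpos : ∀ x ∈ Ioo a b, 0 < x ^ 3 + A * x + B) (ha0 : a ^ 3 + A * a + B = 0) :
    0 < 3 * a ^ 2 + A := by
  have hq : ∀ x ∈ Icc a b, 0 ≤ x ^ 2 + a * x + a ^ 2 + A := by
    refine nonneg_on_Icc_of_pos_on_Ioo (by fun_prop) hab fun x hx => ?_
    have hfx := hpos x hx
    have hid : x ^ 3 + A * x + B = (x - a) * (x ^ 2 + a * x + a ^ 2 + A) := by
      linear_combination ha0
    rw [hid] at hfx
    exact pos_of_mul_pos_right hfx (sub_pos.2 hx.1).le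
  have h3 : 0 ≤ 3 * a ^ 2 + A := by
    have h := hq a ⟨le_rfl, hab.le⟩
    nlinarith [h]
  exact lt_of_le_of_ne h3 (deriv_ne_zero_of_root hD ha0).symm

/-- If `f > 0` on `(a, b)` and `f(b) = 0` then `f′(b) < 0`: `f(x) = (x − b) · q(x)` with
`q(x) = x² + bx + b² + A < 0` on `(a, b)`, hence `q(b) = f′(b) ≤ 0`, and `f′(b) ≠ 0`. [folklore] -/
theorem deriv_neg_of_root_right {A B a b : ℝ} (hab : a < b) (hD : 4 * A ^ 3 + 27 * B ^ 2 ≠ 0)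
    (hpos : ∀ x ∈ Ioo a b, 0 < x ^ 3 + A * x + B) (hb0 : b ^ 3 + A * b + B = 0) :
    3 * b ^ 2 + A < 0 := by
  have hq : ∀ x ∈ Icc a b, 0 ≤ -(x ^ 2 + b * x + b ^ 2 + A) := by
    refine nonneg_on_Icc_of_pos_on_Ioo (by fun_prop) hab fun x hx => ?_
    have hfx := hpos x hx
    have hid : x ^ 3 + A * x + B = (b - x) * -(x ^ 2 + b * x + b ^ 2 + A) := by
      linear_combination hb0
    rw [hid] at hfx
    exact pos_of_mul_pos_right hfx (sub_pos.2 hx.2).le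
  have h3 : 3 * b ^ 2 + A ≤ 0 := by
    have h := hq b ⟨hab.le, le_rfl⟩
    nlinarith [h]
  exact lt_of_le_of_ne h3 (deriv_ne_zero_of_root hD hb0)

/-! ## The reparametrisation `x(t) = a + (b − a)(3t² − 2t³)` -/

/-- The cubic chart `x` maps `[0, 1]` into `[a, b]`: `x(t) − a = (b − a) t² (3 − 2t)` and
`b − x(t) = (b − a)(1 − t)²(1 + 2t)` (and `(0, 1)` into `(a, b)`). [folklore] -/
theorem cubicChart_mem_Icc {a b : ℝ} (hab : a < b) {t : ℝ} (ht : t ∈ Icc (0 : ℝ) 1) :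
    a + (b - a) * (3 * t ^ 2 - 2 * t ^ 3) ∈ Icc a b := by
  have h1 : 0 ≤ (b - a) * t ^ 2 * (3 - 2 * t) :=
    mul_nonneg (mul_nonneg (sub_pos.2 hab).le (sq_nonneg t)) (by linarith [ht.2])
  have h2 : 0 ≤ (b - a) * (1 - t) ^ 2 * (1 + 2 * t) :=
    mul_nonneg (mul_nonneg (sub_pos.2 hab).le (sq_nonneg _)) (by linarith [ht.1])
  constructor <;> nlinarith [h1, h2]

/-! ## `√f(x(t))` is `C¹` on `[0, 1]` -/

/-- **`t ↦ √f(x(t))` is `C¹` on `[0,1]`** for `f = x³ + Ax + B > 0` on `(a,b)`, `4A³ + 27B² ≠ 0`,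
`x(t) = a + (b − a)(3t² − 2t³)`: off the zeros of `f ∘ x` this is the chain rule; a zero can only sit at
`t = 0` (resp. `t = 1`), where `f(x(t)) = t² h(t)` (resp. `(1 − t)² h(t)`) with `h` polynomial and
`h(0) = 3(b − a) f′(a) > 0` (resp. `h(1) = −3(b − a) f′(b) > 0`). [folklore] -/
theorem sqrt_comp_contDiffOn {A B a b : ℝ} {f xt : ℝ → ℝ} (hf : ∀ x, f x = x ^ 3 + A * x + B)
    (hxt : ∀ t, xt t = a + (b - a) * (3 * t ^ 2 - 2 * t ^ 3)) (hab : a < b)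
    (hD : 4 * A ^ 3 + 27 * B ^ 2 ≠ 0) (hpos : ∀ x ∈ Ioo a b, 0 < f x) :
    ContDiffOn ℝ 1 (fun t => Real.sqrt (f (xt t))) (Icc 0 1) := by
  have hfe : f = fun x => x ^ 3 + A * x + B := funext hf
  have hxe : xt = fun t => a + (b - a) * (3 * t ^ 2 - 2 * t ^ 3) := funext hxt
  have hpos' : ∀ x ∈ Ioo a b, 0 < x ^ 3 + A * x + B := fun x hx => by simpa only [hf] using hpos x hx
  have hg_cd : ContDiff ℝ 1 (fun t => f (xt t)) := by
    rw [hfe, hxe]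
    fun_prop
  intro t₀ ht₀
  rcases ne_or_eq (f (xt t₀)) 0 with h0 | h0
  · exact (hg_cd.contDiffAt.sqrt h0).contDiffWithinAt
  have ht01 : t₀ = 0 ∨ t₀ = 1 := by
    rcases eq_or_lt_of_le ht₀.1 with h | h
    · exact Or.inl h.symm
    rcases eq_or_lt_of_le ht₀.2 with h' | h'
    · exact Or.inr h'
    have hx : xt t₀ ∈ Ioo a b := by
      -- `x(t) − a = (b − a) t² (3 − 2t) > 0` and `b − x(t) = (b − a)(1 − t)²(1 + 2t) > 0` on `(0, 1)`
      have h1 : 0 < (b - a) * t₀ ^ 2 * (3 - 2 * t₀) :=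
        mul_pos (mul_pos (sub_pos.2 hab) (pow_pos h 2)) (by linarith)
      have h2 : 0 < (b - a) * (1 - t₀) ^ 2 * (1 + 2 * t₀) :=
        mul_pos (mul_pos (sub_pos.2 hab) (pow_pos (sub_pos.2 h') 2)) (by linarith)
      rw [hxt]
      constructor <;> nlinarith [h1, h2]
    exact absurd h0 (hpos _ hx).ne'
  rcases ht01 with rfl | rfl
  · -- `t₀ = 0`, `f(a) = 0`
    have hx0 : xt 0 = a := by rw [hxt]; ring
    have ha0 : a ^ 3 + A * a + B = 0 := by rw [← hf, ← hx0]; exact h0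
    have hd : 0 < 3 * a ^ 2 + A := deriv_pos_of_root_left hab hD hpos' ha0
    refine contDiffWithinAt_sqrt_of_eq_sq_mul (φ := fun t => t)
      (h := fun t => (b - a) * (3 - 2 * t) * (xt t ^ 2 + a * xt t + a ^ 2 + A)) ht₀
      contDiffAt_id ?_ ?_ (fun t ht => ht.1) (fun t _ => ?_)
    · rw [hxe]
      fun_prop
    · show (b - a) * (3 - 2 * 0) * (xt 0 ^ 2 + a * xt 0 + a ^ 2 + A) ≠ 0
      rw [hx0]
      have : 0 < (b - a) * (3 - 2 * 0) * (a ^ 2 + a * a + a ^ 2 + A) :=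
        mul_pos (mul_pos (sub_pos.2 hab) (by norm_num)) (by nlinarith [hd])
      exact this.ne'
    · simp only [hf, hxt]
      linear_combination ha0
  · -- `t₀ = 1`, `f(b) = 0`
    have hx1 : xt 1 = b := by rw [hxt]; ring
    have hb0 : b ^ 3 + A * b + B = 0 := by rw [← hf, ← hx1]; exact h0
    have hd : 3 * b ^ 2 + A < 0 := deriv_neg_of_root_right hab hD hpos' hb0
    refine contDiffWithinAt_sqrt_of_eq_sq_mul (φ := fun t => 1 - t)
      (h := fun t => (b - a) * (1 + 2 * t) * -(xt t ^ 2 + b * xt t + b ^ 2 + A)) ht₀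
      (contDiffAt_const.sub contDiffAt_id) ?_ ?_ (fun t ht => sub_nonneg.2 ht.2) (fun t _ => ?_)
    · rw [hxe]
      fun_prop
    · show (b - a) * (1 + 2 * 1) * -(xt 1 ^ 2 + b * xt 1 + b ^ 2 + A) ≠ 0
      rw [hx1]
      have : 0 < (b - a) * (1 + 2 * 1) * -(b ^ 2 + b * b + b ^ 2 + A) :=
        mul_pos (mul_pos (sub_pos.2 hab) (by norm_num)) (by nlinarith [hd])
      exact this.ne'
    · simp only [hf, hxt]
      linear_combination hb0

/-! ## The path -/

/-- THE PATH, abstract form: for `f = x³ + Ax + B`, `x(t) = a + (b − a)(3t² − 2t³)` as functions,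
`t ↦ (x(t), √f(x(t)))` is a `C¹` path on `E_{A,B}` with algebraic end points and `ℚ`-semialgebraic
real and imaginary parts on `[0,1]`. [folklore] -/
theorem exists_path {A B a b : ℝ} {f xt : ℝ → ℝ} (hf : ∀ x, f x = x ^ 3 + A * x + B)
    (hxt : ∀ t, xt t = a + (b - a) * (3 * t ^ 2 - 2 * t ^ 3))
    (hA : IsAlgebraic ℚ A) (hB : IsAlgebraic ℚ B) (ha : IsAlgebraic ℚ a) (hb : IsAlgebraic ℚ b)
    (hab : a < b) (hD : 4 * A ^ 3 + 27 * B ^ 2 ≠ 0) (hpos : ∀ x ∈ Ioo a b, 0 < f x) :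
    ∃ γ : CurvePath (weierCurve (A : ℂ) (B : ℂ)),
      (∀ t : ℝ, γ.toFun t = ![((xt t : ℝ) : ℂ), ((Real.sqrt (f (xt t)) : ℝ) : ℂ)]) ∧
      IsSemialgebraicMapOn ℚ {z : Fin 1 → ℝ | z 0 ∈ Icc (0 : ℝ) 1}
        (fun z => Fin.append (fun i => (γ.toFun (z 0) i).re) (fun i => (γ.toFun (z 0) i).im)) := by
  have hfe : f = fun x => x ^ 3 + A * x + B := funext hf
  have hxe : xt = fun t => a + (b - a) * (3 * t ^ 2 - 2 * t ^ 3) := funext hxt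
  -- values at the end points
  have hx0 : xt 0 = a := by rw [hxt]; ring
  have hx1 : xt 1 = b := by rw [hxt]; ring
  have hfalg : ∀ {e : ℝ}, IsAlgebraic ℚ e → IsAlgebraic ℚ (Real.sqrt (f e)) := fun {e} he => by
    -- `f e` is algebraic, and the real square root of a real algebraic number `r` is algebraic
    -- (`(√r)² = r` for `r ≥ 0`, `√r = 0` for `r < 0`)
    have hr : IsAlgebraic ℚ (f e) := by
      rw [hf]
      exact ((he.pow 3).add (hA.mul he)).add hB
    rcases le_or_gt 0 (f e) with h | h
    · exact IsAlgebraic.of_pow two_pos (by rwa [Real.sq_sqrt h])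
    · rw [Real.sqrt_eq_zero'.mpr h.le]
      exact isAlgebraic_zero
  -- `f ∘ x ≥ 0` on `[0, 1]`
  have hf_cont : Continuous f := by rw [hfe]; fun_prop
  have hf_nonneg : ∀ x ∈ Icc a b, 0 ≤ f x := nonneg_on_Icc_of_pos_on_Ioo hf_cont hab hpos
  have hg_nonneg : ∀ t ∈ Icc (0 : ℝ) 1, 0 ≤ f (xt t) := fun t ht =>
    hf_nonneg _ (by rw [hxt]; exact cubicChart_mem_Icc hab ht)
  -- regularity
  have hx_cd : ContDiff ℝ 1 xt := by rw [hxe]; fun_prop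
  have hs_cd : ContDiffOn ℝ 1 (fun t => Real.sqrt (f (xt t))) (Icc 0 1) :=
    sqrt_comp_contDiffOn hf hxt hab hD hpos
  let γ : CurvePath (weierCurve (A : ℂ) (B : ℂ)) :=
    { toFun := fun t => ![((xt t : ℝ) : ℂ), ((Real.sqrt (f (xt t)) : ℝ) : ℂ)]
      contDiffOn := by
        refine contDiffOn_pi.2 fun i => ?_
        fin_cases i
        · exact Complex.ofRealCLM.contDiff.comp_contDiffOn hx_cd.contDiffOn
        · exact Complex.ofRealCLM.contDiff.comp_contDiffOn hs_cd
      mem_points := fun t ht => by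
        rw [Weier.mem_points_iff, Weier.eval_fPoly]
        simp only [Matrix.cons_val_one, Matrix.cons_val_zero]
        have h := Real.sq_sqrt (hg_nonneg t ht)
        rw [hf] at h ⊢
        exact_mod_cast h
      algebraic_zero := fun i => by
        fin_cases i
        · show IsAlgebraic ℚ ((xt 0 : ℝ) : ℂ)
          rw [hx0]
          exact ha.algebraMap
        · show IsAlgebraic ℚ ((Real.sqrt (f (xt 0)) : ℝ) : ℂ)
          rw [hx0]
          exact (hfalg ha).algebraMap
      algebraic_one := fun i => by
        fin_cases i
        · show IsAlgebraic ℚ ((xt 1 : ℝ) : ℂ)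
          rw [hx1]
          exact hb.algebraMap
        · show IsAlgebraic ℚ ((Real.sqrt (f (xt 1)) : ℝ) : ℂ)
          rw [hx1]
          exact (hfalg hb).algebraMap }
  have hγ : γ.toFun = fun t : ℝ =>
      (![((xt t : ℝ) : ℂ), ((Real.sqrt (f (xt t)) : ℝ) : ℂ)] : Fin 2 → ℂ) := rfl
  refine ⟨γ, fun t => rfl, ?_⟩
  -- the realified path is `ℚ`-semialgebraic on `[0, 1]`
  have hdom : IsSemialgebraic ℚ {z : Fin 1 → ℝ | z 0 ∈ Icc (0 : ℝ) 1} := Realises.isSemialgebraic_IccDom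
  have hz : IsSemialgebraicFunOn ℚ {z : Fin 1 → ℝ | z 0 ∈ Icc (0 : ℝ) 1} (fun z => z 0) :=
    (isSemialgebraicFunOn_aeval hdom (X 0)).congr fun z _ => by simp
  have hX : IsSemialgebraicFunOn ℚ {z : Fin 1 → ℝ | z 0 ∈ Icc (0 : ℝ) 1} (fun z => xt (z 0)) :=
    ((isSemialgebraicFunOn_const_of_isAlgebraic hdom ha).fun_add
      ((isSemialgebraicFunOn_const_of_isAlgebraic hdom (hb.sub ha)).fun_mul
        (((isSemialgebraicFunOn_const_natCast hdom 3).fun_mul (hz.fun_pow 2)).fun_sub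
          ((isSemialgebraicFunOn_const_natCast hdom 2).fun_mul (hz.fun_pow 3))))).congr
      fun z _ => by rw [hxt]; push_cast; ring
  have hG : IsSemialgebraicFunOn ℚ {z : Fin 1 → ℝ | z 0 ∈ Icc (0 : ℝ) 1} (fun z => f (xt (z 0))) :=
    (((hX.fun_pow 3).fun_add ((isSemialgebraicFunOn_const_of_isAlgebraic hdom hA).fun_mul hX)).fun_add
      (isSemialgebraicFunOn_const_of_isAlgebraic hdom hB)).congr fun z _ => (hf _).symm
  have hS := hG.fun_sqrt
  show IsSemialgebraicMapOn ℚ {z : Fin 1 → ℝ | z 0 ∈ Icc (0 : ℝ) 1}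
    (fun z => Fin.append (m := 2) (n := 2) (fun i => (γ.toFun (z 0) i).re)
      (fun i => (γ.toFun (z 0) i).im))
  refine IsSemialgebraicMapOn.of_forall hdom fun j => ?_
  refine Fin.addCases (fun i => ?_) (fun i => ?_) j
  · simp only [Fin.append_left, hγ]
    fin_cases i
    · exact hX.congr fun z _ => by simp
    · exact hS.congr fun z _ => by simp
  · simp only [Fin.append_right, hγ]
    fin_cases i <;> exact (isSemialgebraicFunOn_natCast hdom 0).congr fun z _ => by simp

/-- STUB `stub_ellPath` — THE PATH.  For algebraic `A, B, a < b` with `4A³ + 27B² ≠ 0` and `f > 0` on `(a,b)`,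
`t ↦ (x(t), √f(x(t)))` with `x(t) = a + (b − a)(3t² − 2t³)` is a `C¹` path on `E_{A,B}` with algebraic end
points and `ℚ`-semialgebraic real and imaginary parts on `[0,1]` (at an end point where `f` vanishes it does so
simply, so `f(x(t))` has a zero of order exactly `2` there and its square root is `C¹`). [folklore] -/
theorem stub_ellPath : ∀ (A B a b : ℝ), IsAlgebraic ℚ A → IsAlgebraic ℚ B → IsAlgebraic ℚ a → IsAlgebraic ℚ b →
    a < b → 4 * A ^ 3 + 27 * B ^ 2 ≠ 0 → (∀ x ∈ Set.Ioo a b, 0 < x ^ 3 + A * x + B) →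
    ∃ γ : CurvePath (weierCurve (A : ℂ) (B : ℂ)),
      (∀ t : ℝ, γ.toFun t = ![(((a + (b - a) * (3 * t ^ 2 - 2 * t ^ 3)) : ℝ) : ℂ),
        ((Real.sqrt ((a + (b - a) * (3 * t ^ 2 - 2 * t ^ 3)) ^ 3 + A * (a + (b - a) * (3 * t ^ 2 - 2 * t ^ 3)) + B) : ℝ) : ℂ)]) ∧
      IsSemialgebraicMapOn ℚ {z : Fin 1 → ℝ | z 0 ∈ Set.Icc (0 : ℝ) 1}
        (fun z => Fin.append (fun i => (γ.toFun (z 0) i).re) (fun i => (γ.toFun (z 0) i).im)) := by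
  intro A B a b hA hB ha hb hab hD hpos
  exact exists_path (f := fun x => x ^ 3 + A * x + B)
    (xt := fun t => a + (b - a) * (3 * t ^ 2 - 2 * t ^ 3)) (fun _ => rfl) (fun _ => rfl)
    hA hB ha hb hab hD hpos

end Summit.KontsevichZagierPeriods.SymplecticScissors.RealOnePeriodRelations.EllipticLayer

end
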